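import Mathlib
import Summits.CriticalPhenomena.SAWScalingLimit.Theorems.SAWDefectDecoherenceSectorSlavingDefs
import Summits.CriticalPhenomena.SAWScalingLimit.Theorems.SAWDefectDecoherenceDefectDecoherenceSsTipRegroupingAux1
import Summits.CriticalPhenomena.SAWScalingLimit.Theorems.SAWDefectDecoherenceDefectDecoherenceSsTipRegroupingAux2
import HarnessLib

/-!
# Tip regrouping (stub `stub_tipRegrouping` of the line `sector-slaving`, crux `DefectDecoherence`,
stmt-CriticalPhenomena-8549)

At a `1`-deep vertex `v` of `Λ`, for an adjacent boundary root `a = s(u,w)` (`u ∉ Λ ∋ w`):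
`T(v) = κ · (x_c⁻¹ Ā_D(v) + 2 sin(π/24) A_D(v))` and `M(v) = x_c⁻¹ Ā_0(v) + 2 A_0(v)`
(`T = defect`, `M = mass`, `κ = tipPhase`, `Ā_ξ = viaSum`, `A_ξ = arrivalSum`, `D = 13/8`).

Proof.  The walks `a → s(t,v)` (`t ∼ v`) split by their last vertex (`tip_sum_split_last`).
Via-`t` walks are exactly the terms of `Ā(v)` at the dart `t → v`; with the lifted arrival angle
`Θ = θ_a + W`, `e^{iΘ} = (c_v - c_t)/‖·‖` (`tip_exp_lifted_direction`), the coefficient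
`conj(mid{v,t} - c_v) = -(ℓ/2) e^{-iΘ}` and `e^{-i(5/8)W} = e^{i(5/8)θ_a} e^{-i(5/8)Θ}` combine to
`κ x_c⁻¹ · x_c^{ℓ+1} e^{-i(13/8)Θ}` (`tip_viaT_term`).  Via-`v` walks are the clean arrivals `ω` at `v`
prolonged by `v` towards one of the two other mid-edges (`tip_sum_viaV`); the prolongation turns by
`∓π/3` at `v` and the two coefficients are `(ℓ/2) e^{-iΘ(ω)} e^{±iπ/3}`, so the pair contributes
`(ℓ/2) e^{i(5/8)θ_a} e^{-i(13/8)Θ(ω)} x_c^{ℓ+1} · 2cos(13π/24)` and `2cos(13π/24) = -2 sin(π/24)`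
(`tip_pair_sum`).  The mass identity is the same bookkeeping at `ξ = 0`.

Sources: H. Duminil-Copin, S. Smirnov, Ann. of Math. 175 (2012) (arXiv:1007.0575), §2 (proof of
Lemma 1); the line card `Lines/sector-slaving.md`.
-/

noncomputable section

open scoped BigOperators ComplexConjugate Classical
open Literature.Probability.LatticeModels Literature.Probability.RandomPlanarGeometry.SAW
open Summit.CriticalPhenomena.SAWScalingLimit.Theorems.DefectDecoherence.TipMartingale

namespace Summit.CriticalPhenomena.SAWScalingLimit.Theorems.DefectDecoherence.SectorSlaving

variable {Λ : Finset HexVertex} {u w v t : HexVertex}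

/-! ### Constants -/

/-- `1/√3 = 2 · (√3/6)`. [folklore] -/
theorem tip_inv_sqrt_three : (Real.sqrt 3)⁻¹ = 2 * (Real.sqrt 3 / 6) := by
  have h3 : Real.sqrt 3 * Real.sqrt 3 = 3 := Real.mul_self_sqrt (by norm_num)
  have h0 : Real.sqrt 3 ≠ 0 := Real.sqrt_ne_zero'.2 (by norm_num)
  field_simp
  linarith

/-- `e^{i·13π/24} + e^{-i·13π/24} = -2 sin(π/24)`. [folklore] -/
theorem tip_two_cos :
    Complex.exp (((13 * Real.pi / 24 : ℝ) : ℂ) * Complex.I) +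
      Complex.exp (-((13 * Real.pi / 24 : ℝ) : ℂ) * Complex.I) =
      ((-(2 * Real.sin (Real.pi / 24)) : ℝ) : ℂ) := by
  rw [← Complex.two_cos, ← Complex.ofReal_cos,
    show 13 * Real.pi / 24 = Real.pi / 24 + Real.pi / 2 by ring, Real.cos_add_pi_div_two]
  push_cast
  ring

/-! ### The via-`t` terms -/

/-- **Via-`t` term.** For a walk `γ : s(u,w) → s(t,v)` with last vertex `t` (arriving at `mid{t,v}`
pointing into `v`), `conj(mid{t,v} - c_v) · e^{-i(5/8)W} x_c^ℓ = κ x_c⁻¹ · x_c^{ℓ+1} e^{-i(13/8)Θ}`.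
[folklore] -/
theorem tip_viaT_term (huw : hexGraph.Adj u w) (hu : u ∉ Λ) (hvt : hexGraph.Adj v t)
    (γ : HexMidEdgeSAW Λ s(u, w) s(t, v)) (ht : γ.verts.getLast? = some t) :
    (starRingEnd ℂ) (hexMidpoint s(t, v) - hexCenter v) * γ.weight xc (5 / 8) =
      tipPhase u w * ((xc⁻¹ : ℝ) : ℂ) * ((xc : ℂ) ^ (γ.length + 1) *
        Complex.exp (-Complex.I * ((13 / 8 : ℝ) : ℂ) * ((rootAngle u w + γ.winding : ℝ) : ℂ))) := by
  have hd := tip_hexCenter_sub_eq_norm_mul_exp huw hu hvt.symm γ ht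
  rw [norm_hexCenter_sub_of_adj hvt.symm] at hd
  have hm : hexMidpoint s(t, v) - hexCenter v = -(hexCenter v - hexCenter t) / 2 := by
    rw [hexMidpoint_mk]; ring
  have hconj : (starRingEnd ℂ) (hexMidpoint s(t, v) - hexCenter v) =
      -(((Real.sqrt 3)⁻¹ : ℝ) : ℂ) / 2 *
        Complex.exp (-((rootAngle u w + γ.winding : ℝ) : ℂ) * Complex.I) := by
    rw [hm, hd, map_div₀, map_neg, map_mul, Complex.conj_ofReal, ← Complex.exp_conj, map_mul,
      Complex.conj_ofReal, Complex.conj_I, map_ofNat]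
    ring_nf
  have hx : (xc : ℂ) ≠ 0 := by exact_mod_cast xc_pos.ne'
  have hexp : Complex.exp (-((rootAngle u w + γ.winding : ℝ) : ℂ) * Complex.I) *
      Complex.exp (-Complex.I * ((5 / 8 : ℝ) : ℂ) * (γ.winding : ℂ)) =
      Complex.exp (((5 / 8 * rootAngle u w : ℝ) : ℂ) * Complex.I) *
        Complex.exp (-Complex.I * ((13 / 8 : ℝ) : ℂ) * ((rootAngle u w + γ.winding : ℝ) : ℂ)) := by
    rw [← Complex.exp_add, ← Complex.exp_add]
    congr 1
    push_cast
    ring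
  rw [hconj, HexMidEdgeSAW.weight, tipPhase, tip_inv_sqrt_three]
  calc -(((2 * (Real.sqrt 3 / 6) : ℝ) : ℝ) : ℂ) / 2 *
        Complex.exp (-((rootAngle u w + γ.winding : ℝ) : ℂ) * Complex.I) *
        (Complex.exp (-Complex.I * ((5 / 8 : ℝ) : ℂ) * (γ.winding : ℂ)) * (xc : ℂ) ^ γ.length)
      = ((-(Real.sqrt 3 / 6) : ℝ) : ℂ) * (xc : ℂ) ^ γ.length *
          (Complex.exp (-((rootAngle u w + γ.winding : ℝ) : ℂ) * Complex.I) *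
            Complex.exp (-Complex.I * ((5 / 8 : ℝ) : ℂ) * (γ.winding : ℂ))) := by
        push_cast; ring
    _ = ((-(Real.sqrt 3 / 6) : ℝ) : ℂ) * (((xc⁻¹ : ℝ) : ℂ) * (xc : ℂ) ^ (γ.length + 1)) *
          (Complex.exp (((5 / 8 * rootAngle u w : ℝ) : ℂ) * Complex.I) *
            Complex.exp (-Complex.I * ((13 / 8 : ℝ) : ℂ) *
              ((rootAngle u w + γ.winding : ℝ) : ℂ))) := by
        rw [hexp, Complex.ofReal_inv, pow_succ, mul_comm ((xc : ℂ) ^ γ.length),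
          inv_mul_cancel_left₀ hx]
    _ = _ := by ring

/-! ### The via-`v` pairs -/

/-- **Pair sum.** For a clean arrival `ω : s(u,w) → s(s,v)` at `v` through the dart `s → v`, the
two prolongations `ω ++ [v] → mid{v,t}`, `t ∈ star Λ v ∖ {s}`, contribute together
`κ · 2 sin(π/24) · x_c^{ℓ(ω)+1} e^{-i(13/8)Θ(ω)}` to the defect (turns `∓π/3` at `v`,
`2cos(13π/24) = -2sin(π/24)`). [folklore] -/
theorem tip_pair_sum (huw : hexGraph.Adj u w) (hu : u ∉ Λ) (hΛ : ∀ t, hexGraph.Adj v t → t ∈ Λ)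
    {s : HexVertex} (hs : hexGraph.Adj v s) (ω : HexMidEdgeSAW Λ s(u, w) s(s, v))
    (hlast : ω.verts.getLast? = some s) :
    ∑ t ∈ star Λ v, (if s = t then 0 else
      (starRingEnd ℂ) (hexMidpoint s(t, v) - hexCenter v) *
        lw s(u, w) s(t, v) (5 / 8) (ω.verts ++ [v])) =
      tipPhase u w * ((2 * Real.sin (Real.pi / 24) : ℝ) : ℂ) * ((xc : ℂ) ^ (ω.length + 1) *
        Complex.exp (-Complex.I * ((13 / 8 : ℝ) : ℂ) * ((rootAngle u w + ω.winding : ℝ) : ℂ))) := by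
  rw [tip_sum_star_ite hs hΛ]
  obtain ⟨L, hL⟩ : ∃ L, ω.verts = L ++ [s] := ⟨_, (List.dropLast_append_getLast? s hlast).symm⟩
  have hW : ω.winding = winding (hexMidpoint s(u, w) :: (L ++ [s]).map hexCenter ++
      [hexMidpoint s(s, v)]) := by
    rw [HexMidEdgeSAW.winding, HexMidEdgeSAW.points, hL]
  have hlen : (L ++ [s] ++ [v]).length = ω.length + 1 := by
    rw [HexMidEdgeSAW.length, hL, List.length_append, List.length_singleton]
  -- the lifted direction of the dart `s → v`
  have hd := tip_hexCenter_sub_eq_norm_mul_exp huw hu hs.symm ω hlast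
  rw [norm_hexCenter_sub_of_adj hs.symm] at hd
  set Θ : ℝ := rootAngle u w + ω.winding with hΘ
  -- the two list weights
  have hw1 : lw s(u, w) s(rot3 v s, v) (5 / 8) (ω.verts ++ [v]) =
      Complex.exp (-Complex.I * ((5 / 8 : ℝ) : ℂ) * ((ω.winding + -(Real.pi / 3) : ℝ) : ℂ)) *
        (xc : ℂ) ^ (ω.length + 1) := by
    rw [lw, hL, tip_winding_snoc, tip_turning_rot3 hs, ← hW, hlen]
  have hw2 : lw s(u, w) s(rot3 v (rot3 v s), v) (5 / 8) (ω.verts ++ [v]) =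
      Complex.exp (-Complex.I * ((5 / 8 : ℝ) : ℂ) * ((ω.winding + Real.pi / 3 : ℝ) : ℂ)) *
        (xc : ℂ) ^ (ω.length + 1) := by
    rw [lw, hL, tip_winding_snoc, tip_turning_rot3_rot3 hs, ← hW, hlen]
  -- the two coefficients
  have hc1 : (starRingEnd ℂ) (hexMidpoint s(rot3 v s, v) - hexCenter v) =
      (((Real.sqrt 3)⁻¹ : ℝ) : ℂ) / 2 * (Complex.exp (((Real.pi / 3 : ℝ) : ℂ) * Complex.I) *
        Complex.exp (-(Θ : ℂ) * Complex.I)) := by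
    have e : hexMidpoint s(rot3 v s, v) - hexCenter v =
        (hexCenter (rot3 v s) - hexCenter v) / 2 := by rw [hexMidpoint_mk]; ring
    rw [e, tip_hexCenter_rot3_sub, hd, map_div₀, map_mul, map_mul, Complex.conj_ofReal,
      ← Complex.exp_conj, ← Complex.exp_conj, map_mul, map_mul, Complex.conj_ofReal,
      Complex.conj_ofReal, Complex.conj_I, map_ofNat]
    push_cast
    ring_nf
  have hc2 : (starRingEnd ℂ) (hexMidpoint s(rot3 v (rot3 v s), v) - hexCenter v) =
      (((Real.sqrt 3)⁻¹ : ℝ) : ℂ) / 2 * (Complex.exp (-((Real.pi / 3 : ℝ) : ℂ) * Complex.I) *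
        Complex.exp (-(Θ : ℂ) * Complex.I)) := by
    have e : hexMidpoint s(rot3 v (rot3 v s), v) - hexCenter v =
        (hexCenter (rot3 v (rot3 v s)) - hexCenter v) / 2 := by rw [hexMidpoint_mk]; ring
    rw [e, tip_hexCenter_rot3_rot3_sub, hd, map_div₀, map_mul, map_mul, Complex.conj_ofReal,
      ← Complex.exp_conj, ← Complex.exp_conj, map_mul, map_mul, Complex.conj_ofReal,
      Complex.conj_ofReal, Complex.conj_I, map_ofNat]
    push_cast
    ring_nf
  rw [hw1, hw2, hc1, hc2]
  -- collect the exponentials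
  have h1 : Complex.exp (((Real.pi / 3 : ℝ) : ℂ) * Complex.I) * Complex.exp (-(Θ : ℂ) * Complex.I) *
      Complex.exp (-Complex.I * ((5 / 8 : ℝ) : ℂ) * ((ω.winding + -(Real.pi / 3) : ℝ) : ℂ)) =
      Complex.exp (((5 / 8 * rootAngle u w : ℝ) : ℂ) * Complex.I) *
        Complex.exp (-Complex.I * ((13 / 8 : ℝ) : ℂ) * (Θ : ℂ)) *
          Complex.exp (((13 * Real.pi / 24 : ℝ) : ℂ) * Complex.I) := by
    simp only [← Complex.exp_add, hΘ]
    congr 1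
    push_cast
    ring
  have h2 : Complex.exp (-((Real.pi / 3 : ℝ) : ℂ) * Complex.I) * Complex.exp (-(Θ : ℂ) * Complex.I) *
      Complex.exp (-Complex.I * ((5 / 8 : ℝ) : ℂ) * ((ω.winding + Real.pi / 3 : ℝ) : ℂ)) =
      Complex.exp (((5 / 8 * rootAngle u w : ℝ) : ℂ) * Complex.I) *
        Complex.exp (-Complex.I * ((13 / 8 : ℝ) : ℂ) * (Θ : ℂ)) *
          Complex.exp (-((13 * Real.pi / 24 : ℝ) : ℂ) * Complex.I) := by
    simp only [← Complex.exp_add, hΘ]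
    congr 1
    push_cast
    ring
  calc (((Real.sqrt 3)⁻¹ : ℝ) : ℂ) / 2 * (Complex.exp (((Real.pi / 3 : ℝ) : ℂ) * Complex.I) *
          Complex.exp (-(Θ : ℂ) * Complex.I)) *
        (Complex.exp (-Complex.I * ((5 / 8 : ℝ) : ℂ) * ((ω.winding + -(Real.pi / 3) : ℝ) : ℂ)) *
          (xc : ℂ) ^ (ω.length + 1)) +
      (((Real.sqrt 3)⁻¹ : ℝ) : ℂ) / 2 * (Complex.exp (-((Real.pi / 3 : ℝ) : ℂ) * Complex.I) *
          Complex.exp (-(Θ : ℂ) * Complex.I)) *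
        (Complex.exp (-Complex.I * ((5 / 8 : ℝ) : ℂ) * ((ω.winding + Real.pi / 3 : ℝ) : ℂ)) *
          (xc : ℂ) ^ (ω.length + 1))
      = (((Real.sqrt 3)⁻¹ : ℝ) : ℂ) / 2 * (xc : ℂ) ^ (ω.length + 1) *
          (Complex.exp (((Real.pi / 3 : ℝ) : ℂ) * Complex.I) * Complex.exp (-(Θ : ℂ) * Complex.I) *
              Complex.exp (-Complex.I * ((5 / 8 : ℝ) : ℂ) *
                ((ω.winding + -(Real.pi / 3) : ℝ) : ℂ)) +
            Complex.exp (-((Real.pi / 3 : ℝ) : ℂ) * Complex.I) * Complex.exp (-(Θ : ℂ) * Complex.I) *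
              Complex.exp (-Complex.I * ((5 / 8 : ℝ) : ℂ) *
                ((ω.winding + Real.pi / 3 : ℝ) : ℂ))) := by ring
    _ = (((Real.sqrt 3)⁻¹ : ℝ) : ℂ) / 2 * (xc : ℂ) ^ (ω.length + 1) *
          (Complex.exp (((5 / 8 * rootAngle u w : ℝ) : ℂ) * Complex.I) *
            Complex.exp (-Complex.I * ((13 / 8 : ℝ) : ℂ) * (Θ : ℂ)) *
            (Complex.exp (((13 * Real.pi / 24 : ℝ) : ℂ) * Complex.I) +
              Complex.exp (-((13 * Real.pi / 24 : ℝ) : ℂ) * Complex.I))) := by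
        rw [h1, h2]; ring
    _ = _ := by
        rw [tip_two_cos, tip_inv_sqrt_three, tipPhase, hΘ]
        push_cast
        ring

/-! ### The stub -/

/-- **Tip regrouping** (stub `stub_tipRegrouping` of the line `sector-slaving`): at a `1`-deep
vertex `v`, `T(v) = κ·(x_c⁻¹ Ā_D(v) + 2 sin(π/24) A_D(v))` and `M(v) = x_c⁻¹ Ā_0(v) + 2 A_0(v)`.
[folklore] -/
theorem stub_tipRegrouping :
    ∀ (Λ : Finset HexVertex) (u w : HexVertex), hexGraph.Adj u w → u ∉ Λ → w ∈ Λ →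
      ∀ v : HexVertex, Deep Λ v 1 →
        defect Λ u w v =
            tipPhase u w *
              (((xc⁻¹ : ℝ) : ℂ) * viaSum Λ s(u, w) (rootAngle u w) (13 / 8) v +
                ((2 * Real.sin (Real.pi / 24) : ℝ) : ℂ) *
                  arrivalSum Λ s(u, w) (rootAngle u w) (13 / 8) v) ∧
          ((mass Λ u w v : ℝ) : ℂ) =
            ((xc⁻¹ : ℝ) : ℂ) * viaSum Λ s(u, w) (rootAngle u w) 0 v +
              2 * arrivalSum Λ s(u, w) (rootAngle u w) 0 v := by
  intro Λ u w huw hu _ v hdeep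
  -- consequences of `1`-depth
  have hv : v ∈ Λ := hdeep v (by simp)
  have hΛ : ∀ t, hexGraph.Adj v t → t ∈ Λ := fun t ht =>
    hdeep t (dist_hexCenter_le_one_of_adj ht.symm)
  have hwv : w ≠ v := by
    rintro rfl
    exact hu (hdeep u (dist_hexCenter_le_one_of_adj huw))
  have hst : ∀ t ∈ star Λ v, t ∈ Λ ∧ hexGraph.Adj v t := fun t ht => tip_mem_star.1 ht
  have hx : (xc : ℂ) ≠ 0 := by exact_mod_cast xc_pos.ne'
  constructor
  · /- (i) the defect -/
    have key : ∀ t ∈ star Λ v,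
        (starRingEnd ℂ) (hexMidpoint s(v, t) - hexCenter v) *
            hexParafermionicObservable Λ s(u, w) xc (5 / 8) s(v, t) =
          tipPhase u w * ((xc⁻¹ : ℝ) : ℂ) *
              (∑ γ : HexMidEdgeSAW Λ s(u, w) s(t, v),
                if γ.verts.getLast? = some t then
                  (xc : ℂ) ^ (γ.length + 1) *
                    Complex.exp (-Complex.I * ((13 / 8 : ℝ) : ℂ) *
                      ((rootAngle u w + γ.winding : ℝ) : ℂ))
                else 0) +
            ∑ s ∈ star Λ v, ∑ ω : HexMidEdgeSAW Λ s(u, w) s(s, v),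
              if ω.verts.getLast? = some s ∧ v ∉ ω.verts then
                (if s = t then 0 else
                  (starRingEnd ℂ) (hexMidpoint s(t, v) - hexCenter v) *
                    lw s(u, w) s(t, v) (5 / 8) (ω.verts ++ [v]))
              else 0 := by
      intro t ht
      obtain ⟨htΛ, hvt⟩ := hst t ht
      rw [Sym2.eq_swap (a := v) (b := t), hexParafermionicObservable, Finset.mul_sum,
        tip_sum_split_last hu hv htΛ hvt.symm.ne]
      congr 1
      · rw [Finset.mul_sum]
        refine Finset.sum_congr rfl fun γ _ => ?_
        split_ifs with h
        · exact tip_viaT_term huw hu hvt γ h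
        · rw [mul_zero]
      · exact tip_sum_viaV hu hv hwv ht (fun l =>
          (starRingEnd ℂ) (hexMidpoint s(t, v) - hexCenter v) * lw s(u, w) s(t, v) (5 / 8) l)
    have hB : ∑ t ∈ star Λ v, ∑ s ∈ star Λ v, ∑ ω : HexMidEdgeSAW Λ s(u, w) s(s, v),
        (if ω.verts.getLast? = some s ∧ v ∉ ω.verts then
          (if s = t then 0 else
            (starRingEnd ℂ) (hexMidpoint s(t, v) - hexCenter v) *
              lw s(u, w) s(t, v) (5 / 8) (ω.verts ++ [v]))
        else 0) =
        tipPhase u w * ((2 * Real.sin (Real.pi / 24) : ℝ) : ℂ) *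
          arrivalSum Λ s(u, w) (rootAngle u w) (13 / 8) v := by
      rw [Finset.sum_comm (s := star Λ v) (t := star Λ v)]
      unfold arrivalSum
      rw [Finset.mul_sum]
      refine Finset.sum_congr rfl fun s hs => ?_
      obtain ⟨-, hvs⟩ := hst s hs
      rw [Finset.sum_comm (s := star Λ v) (t := Finset.univ), Finset.mul_sum]
      refine Finset.sum_congr rfl fun ω _ => ?_
      by_cases hc : ω.verts.getLast? = some s ∧ v ∉ ω.verts
      · simp only [if_pos hc]
        exact tip_pair_sum huw hu hΛ hvs ω hc.1
      · simp only [if_neg hc, Finset.sum_const_zero, mul_zero]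
    calc defect Λ u w v
        = ∑ t ∈ star Λ v, (tipPhase u w * ((xc⁻¹ : ℝ) : ℂ) *
              (∑ γ : HexMidEdgeSAW Λ s(u, w) s(t, v),
                if γ.verts.getLast? = some t then
                  (xc : ℂ) ^ (γ.length + 1) *
                    Complex.exp (-Complex.I * ((13 / 8 : ℝ) : ℂ) *
                      ((rootAngle u w + γ.winding : ℝ) : ℂ))
                else 0) +
            ∑ s ∈ star Λ v, ∑ ω : HexMidEdgeSAW Λ s(u, w) s(s, v),
              if ω.verts.getLast? = some s ∧ v ∉ ω.verts then
                (if s = t then 0 else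
                  (starRingEnd ℂ) (hexMidpoint s(t, v) - hexCenter v) *
                    lw s(u, w) s(t, v) (5 / 8) (ω.verts ++ [v]))
              else 0) := Finset.sum_congr rfl key
      _ = tipPhase u w * ((xc⁻¹ : ℝ) : ℂ) * viaSum Λ s(u, w) (rootAngle u w) (13 / 8) v +
            tipPhase u w * ((2 * Real.sin (Real.pi / 24) : ℝ) : ℂ) *
              arrivalSum Λ s(u, w) (rootAngle u w) (13 / 8) v := by
          rw [Finset.sum_add_distrib, ← Finset.mul_sum, hB]
          rfl
      _ = _ := by ring
  · /- (ii) the mass -/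
    have key : ∀ t ∈ star Λ v,
        ((‖hexParafermionicObservable Λ s(u, w) xc 0 s(v, t)‖ : ℝ) : ℂ) =
          ((xc⁻¹ : ℝ) : ℂ) *
              (∑ γ : HexMidEdgeSAW Λ s(u, w) s(t, v),
                if γ.verts.getLast? = some t then
                  (xc : ℂ) ^ (γ.length + 1) *
                    Complex.exp (-Complex.I * ((0 : ℝ) : ℂ) *
                      ((rootAngle u w + γ.winding : ℝ) : ℂ))
                else 0) +
            ∑ s ∈ star Λ v, ∑ ω : HexMidEdgeSAW Λ s(u, w) s(s, v),
              if ω.verts.getLast? = some s ∧ v ∉ ω.verts then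
                (if s = t then 0 else (xc : ℂ) ^ (ω.verts ++ [v]).length)
              else 0 := by
      intro t ht
      obtain ⟨htΛ, hvt⟩ := hst t ht
      rw [Sym2.eq_swap (a := v) (b := t), hexParafermionicObservable_zero_spin, Complex.norm_real,
        Real.norm_of_nonneg (Finset.sum_nonneg fun γ _ => pow_nonneg xc_pos.le _),
        Complex.ofReal_sum]
      simp only [Complex.ofReal_pow]
      rw [tip_sum_split_last hu hv htΛ hvt.symm.ne]
      congr 1
      · rw [Finset.mul_sum]
        refine Finset.sum_congr rfl fun γ _ => ?_
        split_ifs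
        · rw [Complex.ofReal_zero, mul_zero, zero_mul, Complex.exp_zero, mul_one, Complex.ofReal_inv,
            pow_succ, mul_comm ((xc : ℂ) ^ γ.length) (xc : ℂ), inv_mul_cancel_left₀ hx]
        · rw [mul_zero]
      · exact tip_sum_viaV hu hv hwv ht (fun l => (xc : ℂ) ^ l.length)
    have hB : ∑ t ∈ star Λ v, ∑ s ∈ star Λ v, ∑ ω : HexMidEdgeSAW Λ s(u, w) s(s, v),
        (if ω.verts.getLast? = some s ∧ v ∉ ω.verts then
          (if s = t then 0 else (xc : ℂ) ^ (ω.verts ++ [v]).length)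
        else 0) = 2 * arrivalSum Λ s(u, w) (rootAngle u w) 0 v := by
      rw [Finset.sum_comm (s := star Λ v) (t := star Λ v)]
      unfold arrivalSum
      rw [Finset.mul_sum]
      refine Finset.sum_congr rfl fun s hs => ?_
      obtain ⟨-, hvs⟩ := hst s hs
      rw [Finset.sum_comm (s := star Λ v) (t := Finset.univ), Finset.mul_sum]
      refine Finset.sum_congr rfl fun ω _ => ?_
      by_cases hc : ω.verts.getLast? = some s ∧ v ∉ ω.verts
      · simp only [if_pos hc]
        rw [tip_sum_star_ite hvs hΛ]
        simp only [List.length_append, List.length_singleton, HexMidEdgeSAW.length,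
          Complex.ofReal_zero, mul_zero, zero_mul, Complex.exp_zero, mul_one]
        ring
      · simp only [if_neg hc, Finset.sum_const_zero, mul_zero]
    calc ((mass Λ u w v : ℝ) : ℂ)
        = ∑ t ∈ star Λ v, ((‖hexParafermionicObservable Λ s(u, w) xc 0 s(v, t)‖ : ℝ) : ℂ) := by
          rw [mass, Complex.ofReal_sum]
      _ = ∑ t ∈ star Λ v, (((xc⁻¹ : ℝ) : ℂ) *
              (∑ γ : HexMidEdgeSAW Λ s(u, w) s(t, v),
                if γ.verts.getLast? = some t then
                  (xc : ℂ) ^ (γ.length + 1) *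
                    Complex.exp (-Complex.I * ((0 : ℝ) : ℂ) *
                      ((rootAngle u w + γ.winding : ℝ) : ℂ))
                else 0) +
            ∑ s ∈ star Λ v, ∑ ω : HexMidEdgeSAW Λ s(u, w) s(s, v),
              if ω.verts.getLast? = some s ∧ v ∉ ω.verts then
                (if s = t then 0 else (xc : ℂ) ^ (ω.verts ++ [v]).length)
              else 0) := Finset.sum_congr rfl key
      _ = _ := by
          rw [Finset.sum_add_distrib, ← Finset.mul_sum, hB]
          rfl

end Summit.CriticalPhenomena.SAWScalingLimit.Theorems.DefectDecoherence.SectorSlaving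

end
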